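import Summits.ValiantsHypothesis.ValiantsHypothesis.Theorems.KPlusLogSqLawTropicalGradedWalkSignsBoundary
import Summits.ValiantsHypothesis.ValiantsHypothesis.Theorems.KPlusLogSqLawTropicalGradedWalkDomDGlue5
import Summits.ValiantsHypothesis.ValiantsHypothesis.Theorems.KPlusLogSqLawTropicalGradedWalkDomTGlue5
import Summits.ValiantsHypothesis.ValiantsHypothesis.Theorems.KPlusLogSqLawTropicalGradedWalkDomXGlue8
import Summits.ValiantsHypothesis.ValiantsHypothesis.Theorems.KPlusLogSqLawTropicalGradedWalkChainDefs

/-!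
# Route «KPlusLogSqLaw» — GRW-lite (all-`m` `K = 4` family): the chain over the phases `1 ≤ w ≤ m − 1` and the count

HONEST FRAMING.  Helper file of the chain `--supports` the crux `Summit.ValiantsHypothesis.ValiantsHypothesis.Theses.KPlusLogSqLaw.TropicalB`
(item `stmt-ValiantsHypothesis-19771`, route `KPlusLogSqLaw`; cell `pub-symmetroid`, seat val-sym-trop-p3 g15, 2026-08-29), on top of the
dominance theorems `isDominant_D` / `isDominant_T` / `isDominant_X` (`…DomDGlue5`, `…DomTGlue5`, `…DomXGlue8`) and the sign files
`…GradedWalkSigns`, `…GradedWalkSignsBoundary`.  CENSUS-SIDE (lower bound) theorem about the tropical row `(m, 4)`; it says nothing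
about `TropicalB` inside its window, `WeakLifting`, the doors, `MatrixDescartes` or `VP ≠ VNP`, and nothing about the cell's `K = 4`
fork (the family is quadratic).

CONTENT.  The REDUCED GRW-lite chain: the states of the phases `1 ≤ w ≤ n = m − 1` of the design of `…TropicalGradedWalkDefs` in
slope order, WITHOUT the excursion pair `(w,1,0), (w,1,1)` (whose dual certificate, potential `UX1` of `…PotX`, is not typed yet —
dropping a consecutive PAIR keeps the sign alternation) and without phase `0` and phase `m`:
`D(w,0,0), D(w,2,0), X(w,2,1), D(w,3,0), …, X(w,w−1,1), T(w,w,0), …, T(w,w,w)` for each `w`, i.e. `3w − 2` states (`3` for `w = 1`),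
`offP (n+1) = (3n² − n + 4)/2` states in all.  `nxt` is the successor map, `seqR k` the `k`-th state, `ValidR` the state invariant,
`idxR` the rank (so that `seqR k` stays in the phases `≤ n` for `k < offP (n+1)`); slopes increase (`theta_lt_nxt`), every state is
dominant, consecutive signs alternate (`termSign_nxt`) — definitions `nxt`, `seqR`, `ValidR`, `offP`, `posR`, `idxR` in
`…GradedWalkChainDefs.lean` — whence

* `offP_sub_one_le_of_tropRootLawAt_four : TropRootLawAt (n+1) 4 B → offP (n+1) − 1 ≤ B`, and in closed form
* `grw_le_of_tropRootLawAt_four : TropRootLawAt m 4 B → (3m² + 6 − 7m)/2 ≤ B` for every `m ≥ 2`;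
* `not_tropRootLawAt_four_parallelogram_ceiling : 11 ≤ m → ¬ TropRootLawAt m 4 ((m+1)² − 1)` — from `m = 11` on the `K = 4` row
  exceeds the parallelogram (additive exponent type) ceiling of `parallelogram_row_four_iff`, for every `m`.

This is an all-`m` kernel floor of leading coefficient `3/2` for the `K = 4` tropical row (the tree's all-`m` floor of record was
`(m+1)² − 1`, `sq_sub_one_le_of_tropRootLawAt_four`; the new bound exceeds it from `m = 11` on); the located full GRW-lite chain has
`2m² + 2` terms (kernel cells `(6..11, 4)`, `…TropicalCensusEleven…`), the missing `m²/2` being phase `m` and the `u = 1` pairs.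
-/

set_option linter.dupNamespace false
set_option autoImplicit false

namespace Summit.ValiantsHypothesis.ValiantsHypothesis.Theorems.LacunarySymmetroidMatrixDescartes.TropicalCensus

namespace GradedWalk

open Summit.ValiantsHypothesis.ValiantsHypothesis.Theorems.MatrixDescartes.Negative

variable (n : ℕ)

/-! ### the reduced chain: invariant and rank -/

/-- the chain starts at `D(1,0,0)`. -/
theorem seqR_zero : seqR 0 = (1, 0, 0) := rfl

/-- the chain is the iteration of `nxt`. -/
theorem seqR_succ (k : ℕ) : seqR (k + 1) = nxt (seqR k) := by
  unfold seqR; rw [Function.iterate_succ_apply']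

/-- `offP (w+1) = offP w + lenP w` for `w ≥ 1`. -/
theorem offP_succ_of_ne {w : ℕ} (hw : w ≠ 0) : offP (w + 1) = offP w + lenP w := by
  rw [offP, if_neg hw]

/-- `nxt` preserves the state invariant. -/
theorem validR_nxt {s : ℕ × ℕ × ℕ} (h : ValidR s) : ValidR (nxt s) := by
  obtain ⟨w, u, t⟩ := s
  simp only [ValidR, nxt] at *
  split_ifs <;> (try dsimp only at *) <;> omega

/-- every state of the chain satisfies the invariant. -/
theorem validR_seqR (k : ℕ) : ValidR (seqR k) := by
  induction k with
  | zero => rw [seqR_zero]; simp [ValidR]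
  | succ k ih => rw [seqR_succ]; exact validR_nxt ih

/-- `nxt` raises the rank by one. -/
theorem idxR_nxt {s : ℕ × ℕ × ℕ} (h : ValidR s) : idxR (nxt s) = idxR s + 1 := by
  obtain ⟨w, u, t⟩ := s
  simp only [ValidR] at h
  have hoff : offP (w + 1) = offP w + lenP w := offP_succ_of_ne (show w ≠ 0 by omega)
  unfold lenP at hoff
  simp only [nxt, idxR, posR]
  split_ifs <;> (try dsimp only at *) <;> (try rw [hoff]) <;> omega

/-- the `k`-th state has rank `k`. -/
theorem idxR_seqR (k : ℕ) : idxR (seqR k) = k := by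
  induction k with
  | zero => rw [seqR_zero]; simp [idxR, offP, posR]
  | succ k ih => rw [seqR_succ, idxR_nxt (validR_seqR k), ih]

/-- `offP` is monotone. -/
theorem offP_mono : Monotone offP := by
  refine monotone_nat_of_le_succ fun w => ?_
  rw [offP]; omega

/-- the `k`-th state lies in a phase `≤ n` as long as `k < offP (n+1)`. -/
theorem seqR_phase_le (k : ℕ) (hk : k < offP (n + 1)) : (seqR k).1 ≤ n := by
  by_contra hcon
  have h1 : offP (n + 1) ≤ offP (seqR k).1 := offP_mono (by omega)
  have h2 : offP (seqR k).1 ≤ idxR (seqR k) := Nat.le_add_right _ _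
  rw [idxR_seqR] at h2
  omega

/-! ### slopes increase -/

/-- the slope of a state of a phase `w ≤ n` (if-free in `Mw`). -/
theorem theta_of_le {w : ℕ} (hw : w ≤ n) (u t : ℕ) :
    theta n w u t = LL n * w + MM n * u + (if u < w then 4 * (t : ℤ) else 2 * (t : ℤ)) := by
  unfold theta Mw; rw [if_neg (by omega)]

/-- the slope of the first state `D(w,0,0)` of a phase. -/
theorem theta_phase_start (w : ℕ) : theta n w 0 0 = LL n * w := by
  unfold theta; split_ifs <;> simp

/-- `M > 4`. -/
theorem MM_gt_four : 4 < MM n := by unfold MM; linarith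
/-- `M > 0`. -/
theorem MM_pos : 0 < MM n := by unfold MM; positivity

/-- the phase period `L` exceeds the in-phase slope range `(M + 2)·w`. -/
theorem boundary_gap {w : ℕ} (hw : w ≤ n) : (MM n + 2) * (w : ℤ) < LL n := by
  have hwz : (w : ℤ) ≤ n := by exact_mod_cast hw
  unfold MM LL
  nlinarith [hwz, (show (0 : ℤ) ≤ w by positivity), (show (0 : ℤ) ≤ n by positivity)]

/-- the slope increases along the reduced chain. -/
theorem theta_lt_nxt {s : ℕ × ℕ × ℕ} (h : ValidR s) (hw : s.1 ≤ n) :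
    theta n s.1 s.2.1 s.2.2 < theta n (nxt s).1 (nxt s).2.1 (nxt s).2.2 := by
  obtain ⟨w, u, t⟩ := s
  simp only [ValidR] at h
  simp only at hw
  obtain ⟨hw1, hD | hX | hT⟩ := h
  · obtain ⟨huw, ht, hu⟩ := hD
    subst ht
    simp only [nxt, if_pos huw, if_true]
    rcases hu with rfl | hu2
    · simp only [if_true]
      by_cases h2 : 2 < w
      · rw [if_pos h2]; simp only
        rw [theta_of_le n hw, theta_of_le n hw, if_pos huw, if_pos h2]
        have := MM_pos n; push_cast; nlinarith
      · rw [if_neg h2]; simp only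
        rw [theta_of_le n hw, theta_of_le n hw, if_pos huw, if_neg (lt_irrefl w)]
        have := MM_pos n
        have hwz : (1 : ℤ) ≤ w := by exact_mod_cast hw1
        push_cast; nlinarith
    · rw [if_neg (by omega)]; simp only
      rw [theta_of_le n hw, theta_of_le n hw, if_pos huw, if_pos huw]
      push_cast; linarith
  · obtain ⟨hu2, huw, ht⟩ := hX
    subst ht
    simp only [nxt, if_pos huw, one_ne_zero, if_false]
    by_cases h2 : u + 1 < w
    · rw [if_pos h2]; simp only
      rw [theta_of_le n hw, theta_of_le n hw, if_pos huw, if_pos h2]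
      have := MM_gt_four n; push_cast; nlinarith
    · rw [if_neg h2]; simp only
      rw [theta_of_le n hw, theta_of_le n hw, if_pos huw, if_neg (lt_irrefl w)]
      have := MM_gt_four n
      have hwu : (w : ℤ) = u + 1 := by exact_mod_cast (show w = u + 1 by omega)
      push_cast; nlinarith
  · obtain ⟨huw, htw⟩ := hT
    subst huw
    simp only [nxt, lt_irrefl, if_false]
    by_cases h2 : t < u
    · rw [if_pos h2]; simp only
      rw [theta_of_le n hw, theta_of_le n hw, if_neg (lt_irrefl u), if_neg (lt_irrefl u)]
      push_cast; linarith
    · rw [if_neg h2]; simp only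
      rw [theta_of_le n hw, theta_phase_start, if_neg (lt_irrefl u)]
      have hb := boundary_gap n hw
      have htu : (t : ℤ) = u := by exact_mod_cast (show t = u by omega)
      push_cast; nlinarith

/-! ### dominance and sign alternation along the chain -/

/-- every state of the reduced chain in a phase `≤ n` is the unique optimum at its slope. -/
theorem isDominant_validR {s : ℕ × ℕ × ℕ} (h : ValidR s) (hw : s.1 ≤ n) :
    IsDominant (dd n) (vv n) (ee n) (theta n s.1 s.2.1 s.2.2) (cterm n s.1 s.2.1 s.2.2) := by
  obtain ⟨w, u, t⟩ := s
  simp only [ValidR] at h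
  simp only at hw ⊢
  obtain ⟨hw1, ⟨huw, ht, -⟩ | ⟨hu2, huw, ht⟩ | ⟨huw, htw⟩⟩ := h
  · subst ht; exact isDominant_D n w u huw hw
  · subst ht; exact isDominant_X n w u hu2 huw hw
  · subst huw; exact isDominant_T n u t htw hw hw1

/-- consecutive states of the reduced chain have terms of opposite signs. -/
theorem termSign_nxt {s : ℕ × ℕ × ℕ} (h : ValidR s) (hw : (nxt s).1 ≤ n) :
    termSign (ee n) (cterm n s.1 s.2.1 s.2.2) * termSign (ee n) (cterm n (nxt s).1 (nxt s).2.1 (nxt s).2.2) < 0 := by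
  obtain ⟨w, u, t⟩ := s
  simp only [ValidR] at h
  obtain ⟨hw1, hD | hX | hT⟩ := h
  · obtain ⟨huw, ht, hu⟩ := hD
    subst ht
    simp only [nxt, if_pos huw, if_true] at hw ⊢
    rcases hu with rfl | hu2
    · simp only [if_true] at hw ⊢
      by_cases h2 : 2 < w
      · rw [if_pos h2] at hw ⊢; simp only at hw ⊢
        exact termSign_D_zero_two n w h2 hw
      · rw [if_neg h2] at hw ⊢; simp only at hw ⊢
        exact termSign_D_zero_T n w hw1 hw
    · rw [if_neg (by omega)] at hw ⊢; simp only at hw ⊢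
      exact termSign_D_X n w u hu2 huw hw
  · obtain ⟨hu2, huw, ht⟩ := hX
    subst ht
    simp only [nxt, if_pos huw, one_ne_zero, if_false] at hw ⊢
    by_cases h2 : u + 1 < w
    · rw [if_pos h2] at hw ⊢; simp only at hw ⊢
      exact termSign_X_D n w u hu2 h2 hw
    · rw [if_neg h2] at hw ⊢; simp only at hw ⊢
      have hu : u = w - 1 := by omega
      subst hu
      exact termSign_X_T n w (by omega) hw
  · obtain ⟨huw, htw⟩ := hT
    subst huw
    simp only [nxt, lt_irrefl, if_false] at hw ⊢
    by_cases h2 : t < u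
    · rw [if_pos h2] at hw ⊢; simp only at hw ⊢
      exact termSign_T_step n u t h2 hw
    · rw [if_neg h2] at hw ⊢; simp only at hw ⊢
      have ht : t = u := by omega
      subst ht
      exact termSign_boundary n t hw1 hw

/-! ### the count -/

/-- **the tropical row `(m, 4)`, `m = n + 1`, is at least `offP (n+1) − 1`** (the reduced GRW-lite chain has `offP (n+1)` terms). -/
theorem offP_sub_one_le_of_tropRootLawAt_four (B : ℕ) (h : TropRootLawAt (n + 1) 4 B) : offP (n + 1) - 1 ≤ B := by
  rcases Nat.eq_zero_or_pos (offP (n + 1)) with h0 | hpos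
  · rw [h0]; exact Nat.zero_le _
  set N := offP (n + 1) - 1 with hN
  have hN1 : N + 1 = offP (n + 1) := by omega
  have hphase : ∀ k : ℕ, k ≤ N → (seqR k).1 ≤ n := fun k hk => seqR_phase_le n k (by omega)
  exact h (dd n) (vv n) (ee n) N (fun k => theta n (seqR k).1 (seqR k).2.1 (seqR k).2.2)
    (fun k => cterm n (seqR k).1 (seqR k).2.1 (seqR k).2.2)
    (fun i j l => by have := ee_natAbs_lt_two n i j l; omega)
    (by
      refine Fin.strictMono_iff_lt_succ.mpr fun k => ?_
      simp only [Fin.val_castSucc, Fin.val_succ]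
      rw [seqR_succ]
      exact theta_lt_nxt n (validR_seqR k) (hphase k (by omega)))
    (fun k => isDominant_validR n (validR_seqR k) (hphase k (by omega)))
    (fun k => by
      simp only [Fin.val_castSucc, Fin.val_succ]
      rw [seqR_succ]
      exact termSign_nxt n (validR_seqR k) (by rw [← seqR_succ]; exact hphase (k + 1) (by omega)))

/-- closed form of the length: `2 · offP (n+1) + n = 3n² + 4` for `n ≥ 1`. -/
theorem two_mul_offP_succ (n : ℕ) (hn : 1 ≤ n) : 2 * offP (n + 1) + n = 3 * n ^ 2 + 4 := by
  induction n with
  | zero => omega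
  | succ k ih =>
    rcases Nat.eq_zero_or_pos k with rfl | hk
    · simp [offP, lenP]
    · have ih' := ih hk
      rw [offP_succ_of_ne (show k + 1 ≠ 0 by omega)]
      unfold lenP
      have h3 : (k + 1) ^ 2 = k ^ 2 + 2 * k + 1 := by ring
      rw [h3]
      generalize k ^ 2 = q at *
      omega

end GradedWalk

/-- **An all-`m` floor of leading coefficient `3/2` for the `K = 4` tropical census row:** every bound `B` of the tropical row `(m, 4)`,
`m ≥ 2`, satisfies `(3m² − 7m + 6)/2 ≤ B` (written `(3m² + 6 − 7m)/2` in `ℕ`) — the reduced GRW-lite chain has `(3m² − 7m + 8)/2`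
sign-alternating unique optima.
Census side only; nothing here bears on `TropicalB` in its window or on the cell's `K = 4` fork. -/
theorem grw_le_of_tropRootLawAt_four (m B : ℕ) (hm : 2 ≤ m) (h : TropRootLawAt m 4 B) : (3 * m ^ 2 + 6 - 7 * m) / 2 ≤ B := by
  obtain ⟨n, rfl⟩ : ∃ n, m = n + 1 := ⟨m - 1, by omega⟩
  have h1 := GradedWalk.offP_sub_one_le_of_tropRootLawAt_four n B h
  have h2 := GradedWalk.two_mul_offP_succ n (by omega)
  have h3 : (n + 1) ^ 2 = n ^ 2 + 2 * n + 1 := by ring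
  have h4 : n ≤ n ^ 2 := by nlinarith
  rw [h3]
  generalize n ^ 2 = q at *
  omega

/-- **Corollary: from `m = 11` on, the `K = 4` tropical row exceeds the PARALLELOGRAM ceiling `(m+1)² − 1`** of the additive exponent
types (`parallelogram_row_four_iff`, attained by SHIFT-SQUARE): the bound `(m+1)² − 1` is NOT a valid bound for the row `(m, 4)`, witnessed
by the (non-additive: `d₀ + d₃ ≠ d₁ + d₂`) GRW-lite design.  Kernel cells knew this for `6 ≤ m ≤ 11`; this is the all-`m` statement. -/
theorem not_tropRootLawAt_four_parallelogram_ceiling (m : ℕ) (hm : 11 ≤ m) : ¬ TropRootLawAt m 4 ((m + 1) ^ 2 - 1) := by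
  intro h
  have h1 := grw_le_of_tropRootLawAt_four m _ (by omega) h
  have h2 : 11 * m ≤ m ^ 2 := by nlinarith
  have h3 : (m + 1) ^ 2 = m ^ 2 + 2 * m + 1 := by ring
  rw [h3] at h1
  generalize m ^ 2 = q at *
  omega

end Summit.ValiantsHypothesis.ValiantsHypothesis.Theorems.LacunarySymmetroidMatrixDescartes.TropicalCensus
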